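import Literature.AlgebraicGeometry.Modules.DeterminantCocycle
import Literature.AlgebraicGeometry.Modules.AdaptedFrame
import Literature.AlgebraicGeometry.Motives.CrystallineRealization
import HarnessLib

/-!
# Rank-one frame systems: line bundles are classified by their cocycle class

For `𝒪_X`-modules with frame systems of constant rank `1` ("line bundles with chosen local
generators") on a scheme `X`:

* `transitionDet_eq_of_subsingleton` — in rank one the determinant cocycle is the transition function itself;
* `FrameSystem.isFiniteLocallyFree`, `FrameSystem.hasRank` — a module with a frame system of constant
  rank `r` is finite locally free of rank `r` (the tree's `HasRank`); conversely
  `exists_frameSystem_of_hasRank`;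
* `FrameSystem.idx`, `FrameSystem.map_gen_eq` — the single index of a rank-one frame and the rule
  `b_y| = g_{xy} b_x|`; `homOfOverCover` / `isoOfOverCover` — morphisms over a covering open descend
  to `𝒪_X`-modules. The classification theorem (cohomologous cocycles ⇒ isomorphic line bundles,
  Hartshorne III Ex. 4.5) is `Modules/RankOneCocycleIso.lean`.

Everything is proved; no named facts.

## References

* R. Hartshorne, *Algebraic Geometry*, GTM 52 (1977), III Ex. 4.5, II Ex. 1.22. [Hartshorne1977]
-/

noncomputable section

open CategoryTheory AlgebraicGeometry Opposite TopologicalSpace Limits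

namespace Literature.AlgebraicGeometry.Modules

open Literature.AlgebraicGeometry.Motives

universe u

variable {X : Scheme.{u}} {E E₁ E₂ : X.Modules}

/-! ### Rank one: determinants are entries -/

/-- In rank one the determinant of the transition matrix is its unique entry. [folklore] -/
theorem transitionDet_eq_of_subsingleton {W W' V : X.Opens} {I I' : Type u} [Subsingleton I]
    [Subsingleton I'] {n n' : ℕ} (e : SheafOfModules.free I ≅ E.over W)
    (e' : SheafOfModules.free I' ≅ E.over W') (ε : I ≃ Fin n) (ε' : I' ≃ Fin n') (k : V ⟶ W)
    (k' : V ⟶ W') (i : I) (i' : I') :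
    transitionDet e e' ε ε' k k' = transition e e' k k' i i' := by
  haveI : Unique I := uniqueOfSubsingleton i
  haveI : Unique I' := uniqueOfSubsingleton i'
  obtain rfl : n = 1 := by rw [← Nat.card_eq_of_equiv_fin ε, Nat.card_unique]
  obtain rfl : n' = 1 := by rw [← Nat.card_eq_of_equiv_fin ε', Nat.card_unique]
  rw [transitionDet_eq, Matrix.det_fin_one, stdTransition_apply, Subsingleton.elim (ε.symm 0) i,
    Subsingleton.elim (ε'.symm 0) i']

/-- The basis expansion in a frame on a type with a single index: `s = λ(s) · b|_V`. [folklore] -/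
lemma eq_coord_smul_of_subsingleton {W V : X.Opens} {I : Type u} [Fintype I] [Subsingleton I]
    (e : SheafOfModules.free I ≅ E.over W) (k : V ⟶ W) (s : Γ(E, V)) (i : I) :
    s = coord e k s i • E.presheaf.map k.op (basisSection e i) := by
  have h := eq_sum_coord_smul e k s
  rwa [Fintype.sum_subsingleton _ i] at h

/-! ### Frame systems, finite local freeness and rank -/

namespace FrameSystem

variable (F : FrameSystem E)

include F in
/-- A module with a frame system is finite locally free. [folklore] -/
theorem isFiniteLocallyFree : IsFiniteLocallyFree E := fun x =>
  ⟨F.U x, F.mem x, F.I x, Finite.of_equiv _ (F.enum x).symm, ⟨F.frame x⟩⟩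

include F in
/-- **A module with a frame system of constant rank `r` has rank `r`** (the local generators data
of the frames, as in `IsFiniteLocallyFree.isVectorBundle`). [folklore] -/
theorem hasRank (r : ℕ) (h : ∀ x, F.rank x = r) : HasRank E r := by
  let q : SheafOfModules.LocalGeneratorsData.{u} (R := X.ringCatSheaf) E :=
    { I := X
      X := F.U
      coversTop := (Opens.coversTop_iff _ F.U).mpr
        (TopologicalSpace.IsOpenCover.mk (eq_top_iff.mpr fun x _ =>
          TopologicalSpace.Opens.mem_iSup.mpr ⟨x, F.mem x⟩))
      generators := fun x => (SheafOfModules.free.generatingSections (F.I x)).ofEpi (F.frame x).hom }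
  have hq : q.IsLocallyFreeData :=
    { isIso := fun x => by
        change IsIso ((SheafOfModules.free.generatingSections (F.I x)).ofEpi (F.frame x).hom).π
        rw [SheafOfModules.GeneratingSections.ofEpi_π]
        change IsIso ((SheafOfModules.free.generatingSections (F.I x)).π ≫ (F.frame x).hom)
        infer_instance }
  refine ⟨q, hq, fun x => ⟨Finite.of_equiv _ (F.enum x).symm, ?_⟩⟩
  rw [← h x]
  exact Nat.card_eq_of_equiv_fin (F.enum x)

end FrameSystem

/-- **A module of rank `r` has a frame system of constant rank `r`** (choose, at every point, a
member of the cover of a `HasRank` datum). [folklore] -/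
theorem exists_frameSystem_of_hasRank {r : ℕ} (h : HasRank E r) :
    ∃ F : FrameSystem E, ∀ x, F.rank x = r := by
  obtain ⟨q, hq, hr⟩ := h
  choose a ha using fun x => ((Opens.coversTop_iff _ q.X).mp q.coversTop).exists_mem x
  refine ⟨{ U := fun x => q.X (a x)
            mem := ha
            I := fun x => (q.generators (a x)).I
            rank := fun _ => r
            enum := fun x =>
              haveI := (hr (a x)).1
              (Finite.equivFin _).trans (finCongr (hr (a x)).2)
            frame := fun x =>
              haveI := hq.isIso (a x)
              asIso (q.generators (a x)).π }, fun x => rfl⟩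

/-! ### Morphisms of `𝒪_X`-modules from morphisms over a covering open -/

section OverTop

variable {W : X → X.Opens} (hW : ∀ x, x ∈ W x)

include hW in
/-- `V ≤ ⨆ W_x` for a point-indexed cover. [folklore] -/
lemma le_iSup_of_cover (V : X.Opens) : V ≤ iSup W := fun x _ => Opens.mem_iSup.mpr ⟨x, hW x⟩

/-- A morphism `E₁|_{⨆ W_x} → E₂|_{⨆ W_x}` over a covering open gives a morphism `E₁ → E₂`.
[folklore] -/
def homOfOverCover (Φ : E₁.over (iSup W) ⟶ E₂.over (iSup W)) : E₁ ⟶ E₂ where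
  val := PresheafOfModules.homMk
    { app := fun V => AddCommGrpCat.ofHom
        { toFun := fun s => appLE Φ (homOfLE (le_iSup_of_cover hW V.unop)) s
          map_zero' := appLE_zero_right _ _
          map_add' := fun s t => appLE_add_right _ _ s t }
      naturality := fun {V V'} i => by
        ext s
        change appLE Φ (homOfLE _) (E₁.presheaf.map i.unop.op s) =
          E₂.presheaf.map i.unop.op (appLE Φ _ s)
        rw [← appLE_map, Subsingleton.elim (i.unop ≫ homOfLE (le_iSup_of_cover hW V.unop))
          (homOfLE (le_iSup_of_cover hW V'.unop))] }
    (fun V r s => appLE_smul_right Φ _ r s)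

/-- Sections of `homOfOverCover`. [folklore] -/
@[simp]
lemma homOfOverCover_app (Φ : E₁.over (iSup W) ⟶ E₂.over (iSup W)) (V : X.Opens) (s : Γ(E₁, V)) :
    (homOfOverCover hW Φ).app V s = appLE Φ (homOfLE (le_iSup_of_cover hW V)) s := rfl

/-- `homOfOverCover` is compatible with composition. [folklore] -/
lemma homOfOverCover_comp {E₃ : X.Modules} (Φ : E₁.over (iSup W) ⟶ E₂.over (iSup W))
    (Ψ : E₂.over (iSup W) ⟶ E₃.over (iSup W)) :
    homOfOverCover hW (Φ ≫ Ψ) = homOfOverCover hW Φ ≫ homOfOverCover hW Ψ := by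
  apply Scheme.Modules.hom_ext
  intro V
  ext s
  rfl

/-- `homOfOverCover 𝟙 = 𝟙`. [folklore] -/
lemma homOfOverCover_id : homOfOverCover hW (𝟙 (E₁.over (iSup W))) = 𝟙 E₁ := by
  apply Scheme.Modules.hom_ext
  intro V
  ext s
  rfl

/-- An isomorphism over a covering open gives an isomorphism of `𝒪_X`-modules. [folklore] -/
def isoOfOverCover (Φ : E₁.over (iSup W) ≅ E₂.over (iSup W)) : E₁ ≅ E₂ where
  hom := homOfOverCover hW Φ.hom
  inv := homOfOverCover hW Φ.inv
  hom_inv_id := by rw [← homOfOverCover_comp, Φ.hom_inv_id, homOfOverCover_id]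
  inv_hom_id := by rw [← homOfOverCover_comp, Φ.inv_hom_id, homOfOverCover_id]

end OverTop

/-! ### Line bundles with cohomologous cocycles are isomorphic -/

namespace FrameSystem

variable (F : FrameSystem E) (h : ∀ x, F.rank x = 1)

/-- The index of a rank-one frame. [folklore] -/
def idx (x : X) : F.I x :=
  ((F.enum x).trans (finCongr (h x))).symm 0

include h in
/-- A rank-one frame has a single index. [folklore] -/
lemma subsingleton_index (x : X) : Subsingleton (F.I x) :=
  ((F.enum x).trans (finCongr (h x))).injective.subsingleton

/-- Every index of a rank-one frame is the chosen one. [folklore] -/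
lemma eq_idx (x : X) (i : F.I x) : i = F.idx h x :=
  (F.subsingleton_index h x).elim _ _

/-- **`b_y|_V = g_{xy} · b_x|_V`** for a rank-one frame system (`g` its determinant cocycle).
[folklore] -/
theorem map_gen_eq {x y : X} {V : X.Opens} (hx : V ≤ F.U x) (hy : V ≤ F.U y) :
    E.presheaf.map (homOfLE hy).op (basisSection (F.frame y) (F.idx h y)) =
      F.cocycle.g x y V hx hy • E.presheaf.map (homOfLE hx).op (basisSection (F.frame x) (F.idx h x)) := by
  haveI : Fintype (F.I x) := Fintype.ofEquiv _ (F.enum x).symm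
  haveI := F.subsingleton_index h x
  haveI := F.subsingleton_index h y
  rw [map_basisSection_eq_sum_transition (F.frame x) (F.frame y) (homOfLE hx) (homOfLE hy),
    Fintype.sum_subsingleton _ (F.idx h x), FrameSystem.cocycle_g,
    transitionDet_eq_of_subsingleton _ _ _ _ _ _ (F.idx h x) (F.idx h y)]

/-- Every section over `V ≤ U_x` is a multiple of the local generator: `s = λ(s) b_x|_V`.
[folklore] -/
lemma eq_coord_smul_gen {x : X} {V : X.Opens} (k : V ⟶ F.U x) (s : Γ(E, V)) :
    s = coord (F.frame x) k s (F.idx h x) • E.presheaf.map k.op (basisSection (F.frame x) (F.idx h x)) := by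
  haveI : Fintype (F.I x) := Fintype.ofEquiv _ (F.enum x).symm
  haveI := F.subsingleton_index h x
  exact eq_coord_smul_of_subsingleton (F.frame x) k s (F.idx h x)

end FrameSystem

end Literature.AlgebraicGeometry.Modules

end
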